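import Summits.QuantumFields.BalabanUV.T4Continuum.Support.SubstrateLargeFieldNestedSharp
import Summits.QuantumFields.BalabanUV.T4Continuum.Support.SubstrateLocalization
import Literature.MathematicalPhysics.QuantumFieldTheory.Balaban1983to89.B15BasicStep

/-!
# T⁴ programme, SUBSTRATE — `Support/SubstrateROperation`: the 𝐑-OPERATION OF RECORD (MAP S-R ∕ [dict] D-2) on a
# `Setup.LargeFieldDecomp` and on the NESTED decomposition of `Support/SubstrateLargeFieldNested` — [Balaban1989LargeFieldI] (0.3)
# BY NAME through the tree's `B15.BasicStep.RopReal`, the regrouping along the split `Z ↦ Z″` (the quotient `rQuot`), (0.4) BY NAME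
# through `integral_ropReal_eq`, the structural half of (0.5)∕(0.6) through `SubstrateLocalization.locSum`, and the split of record
# on nested histories (`shrinkLast`, `ppNested`, `rNested`)  (v1.0.1: DOCSTRING-ONLY locator fix of `rQuot`, (0.5) is on p. 176)

Audit cell `pub-balaban`, SUBSTRATE cell seat p4; typer MAP v0.3 §2 row S-R RULED → p4, typed in `substrate/typer/SubstrateSketch.v0.3.lean` §R∕§R-N
(names of record: `rOfRecord`, `lfDecompR`, `lfDecompR_total`, `rQuot`, `ROfRecordFibrewise_stmt`, `RPreservesIntegral_stmt`, `rTerm`,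
`RQuotExpansion_stmt`, `shrinkLast`, `IsClassSelector`, `ShrinkLastAdmissible_stmt`, `ShrinkLastIdem_stmt`, `ppNested`, `rNested` — landed here;
the `_stmt`s become the theorems `rOfRecord_fibrewise`, `integral_rOfRecord`, `rQuot_eq_exp_sum_rTerm`, `shrinkLast_mem_admissible`,
`shrinkLast_idem`; `shrinkLast` is defined by structural recursion (refines the sketch's `dropLast`∕`getLast?` form, same values)).
NOTHING of (0.3)∕(0.4) is re-derived: `B15.BasicStep.RopReal`∕`normTerm`∕`fibreIntegral`∕`integral_ropReal_eq` (p176499) ARE the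
formula and its normalisation over `Setup` and are imported BY NAME (no twin).

WHAT IS PRINTED (documentation; read AS AN IMAGE on the render `b2b-balaban-ref1/pages/1989-cmp122-large-field-I/…-p002-x2.png`, p. 176):
*"(𝐑ρ)(V) = Σ_Z ρ(Z″, V) · ∫dV⌈_{Z′} ρ(Z, V) ∕ ∫dV⌈_{Z′} ρ(Z″, V). (0.3) … It satisfies the basic normalization property ∫dV(𝐑ρ)(V) =
∫dV ρ(V). (0.4) … Σ_{Z′⊂Z″ᶜ} ∫dV⌈_{Z′} ρ(Z′ ∪ Z″, V) ∕ ∫dV⌈_{Z′} ρ(Z″, V) = exp Σ_X 𝐑(X, V), (0.5) … (𝐑ρ)(V) = Σ_{Z″} ρ(Z″, V)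
exp Σ_X 𝐑(X, V). (0.6)"*.

WHAT THIS FILE PROVIDES (all `[folklore]` except the DATA readings tagged with their printed locus):
 * §1 `rOfRecord D pp fib := RopReal D.piece pp fib`, `lfDecompR` (+ `lfDecompR_total`, rfl), `rQuot`, and **`rOfRecord_fibrewise`**
   (= `ROfRecordFibrewise_stmt`: for an idempotent split, `𝐑ρ = Σ_{Z″ fixed} ρ(Z″)·rQuot Z″` — `Finset.sum_fiberwise_of_maps_to`);
 * §2 **`integral_rOfRecord`** (= `RPreservesIntegral_stmt` = (0.4): measurable bounded pieces, non-vanishing denominators ⇒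
   `∫ 𝐑ρ = ∫ D.total` — `integral_ropReal_eq` BY NAME);
 * §3 `rTerm` and **`rQuot_eq_exp_sum_rTerm`** (= `RQuotExpansion_stmt`: `locSum` + `Real.exp_log`);
 * §4 (§R-N) `shrinkLast`, `IsClassSelector`, **`shrinkLast_mem_admissible`** (= `ShrinkLastAdmissible_stmt`, needs only `subset`),
   **`shrinkLast_idem`** (= `ShrinkLastIdem_stmt`), `ppNested` (+ `ppNested_idem`), `rNested`, and **`integral_rNested`** (`∫ rNested = ∫ ρ`
   for `0 ≤ ρ ≤ C` measurable, stage weights measurable in `[0,1]`, non-vanishing denominators — (0.4) on the nested decomposition, whose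
   total IS `ρ`).
HONEST FRAMING (T4-DAG p. 1).  Bookkeeping: finite sums, the tree's fibre integrals, Möbius inversion; the provisos of (0.3) (positivity,
non-empty domains), B16's decay∕analyticity of `𝐑(X)` and the choice of the fibre variables `fib` are DISPLAYED data∕hypotheses.  NOT an
estimate of any NE row; spine 0/9 unchanged; NOT infinite volume, NOT a mass gap, NOT Clay.  HONEST DEPENDENCY: continuum YM on T⁴ ⇐ BetaPertH ∧
nine spine estimates (0/9 proved); BetaPertH ⇐ (D1) ∧ (D4) ∧ CAP+tail; G-an2-4 gates asym, D1 and NE2/3/4.  No `sorry`.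
-/

noncomputable section

open scoped BigOperators
open _root_.MeasureTheory

namespace Summit.QuantumFields.BalabanUV.T4Continuum.SubstrateROperation

open Literature.MathematicalPhysics.QuantumFieldTheory.Balaban1983to89
open Literature.MathematicalPhysics.QuantumFieldTheory.Balaban1983to89.B15.BasicStep (fibreIntegral normTerm RopReal
  integral_ropReal_eq)
open Summit.QuantumFields.BalabanUV.T4Continuum.SubstrateLargeField
open Summit.QuantumFields.BalabanUV.T4Continuum.SubstrateLocalization (locTerm ResLattice locSum)

/-! ## §1 The operation of record, its decomposition, and the quotient along the split -/

section R

variable {P : Params} {j : ℕ} {G : Type*} [GaugeGroup G] [MeasurableSpace G] [HaarData G] [DecidableEq (PBond P j)]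

/-- DATA **`rOfRecord`**: the 𝐑-operation (0.3) applied to a represented density — the tree's `RopReal` on the decomposition's
pieces with the split of record `pp : Z ↦ Z″` and the fibre variables `fib Z` (the bond variables of `Z′ = Z ∖ Z″`).
[cite: Balaban1989LargeFieldI, (0.3) p.176] -/
def rOfRecord (D : LargeFieldDecomp P j G) (pp : D.Region → D.Region) (fib : D.Region → Finset (PBond P j)) :
    Density P j G :=
  RopReal D.piece pp fib

/-- Unfolding: `𝐑ρ = Σ_Z ρ(Z″)·∫ρ(Z)∕∫ρ(Z″)` (`normTerm`). [folklore] -/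
theorem rOfRecord_apply (D : LargeFieldDecomp P j G) (pp : D.Region → D.Region) (fib : D.Region → Finset (PBond P j))
    (V : GaugeField P j G) : rOfRecord D pp fib V = ∑ Z, normTerm (fib Z) (D.piece (pp Z)) (D.piece Z) V := rfl

/-- DATA **`lfDecompR`**: `𝐑ρ` is again a represented density over the SAME regions, piece `Z ↦ ρ(Z″)·∫ρ(Z)∕∫ρ(Z″)`
(non-negative: pieces `≥ 0` and fibre integrals are `toReal`s). [folklore] -/
def lfDecompR (D : LargeFieldDecomp P j G) (pp : D.Region → D.Region) (fib : D.Region → Finset (PBond P j)) :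
    LargeFieldDecomp P j G where
  Region := D.Region
  piece := fun Z => normTerm (fib Z) (D.piece (pp Z)) (D.piece Z)
  nonneg := fun Z V => mul_nonneg (D.nonneg (pp Z) V) (div_nonneg ENNReal.toReal_nonneg ENNReal.toReal_nonneg)

/-- Its total IS `rOfRecord` (definitional). [folklore] -/
theorem lfDecompR_total (D : LargeFieldDecomp P j G) (pp : D.Region → D.Region) (fib : D.Region → Finset (PBond P j)) :
    (lfDecompR D pp fib).total = rOfRecord D pp fib := rfl

open Classical in
/-- DATA **`rQuot`**: the 𝐑-quotient at a region `Z″`: `Σ_{Z : pp Z = Z″} ∫dV⌈_{fib Z} ρ(Z) ∕ ∫dV⌈_{fib Z} ρ(Z″)` — the left-hand side of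
(0.5) p. 176 «Σ_{Z′⊂Z″ᶜ} ∫dV⌈_{Z′}ρ(Z′∪Z″,V) ∕ ∫dV⌈_{Z′}ρ(Z″,V) = exp Σ_X ℝ(X,V)» (render `…1989-cmp122-large-field-I-p002-x2.png`); the
DENOMINATOR is the fibre integral of the WHOLE piece `ρ(Z″)`, not of the localized parts that p. 177 goes on to announce (v1.0.1 DOCFIX-LOW,
XREAD leaf-07-g9 journal l.14332: locator p. 177 → p. 176 + this sentence; declarations unchanged). [cite: Balaban1989LargeFieldI, (0.5) p.176] -/
def rQuot (D : LargeFieldDecomp P j G) (pp : D.Region → D.Region) (fib : D.Region → Finset (PBond P j)) (Z'' : D.Region) :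
    Density P j G := fun V =>
  ∑ Z ∈ Finset.univ.filter (fun Z => pp Z = Z''), fibreIntegral (fib Z) (D.piece Z) V / fibreIntegral (fib Z) (D.piece (pp Z)) V

open Classical in
/-- **`𝐑ρ = Σ_{Z″ = pp Z″} ρ(Z″)·rQuot Z″`** for an idempotent split (regrouping (0.3) along the fibres of `pp`; the image of an
idempotent map is its fixed-point set). [folklore] -/
theorem rOfRecord_fibrewise (D : LargeFieldDecomp P j G) (pp : D.Region → D.Region) (fib : D.Region → Finset (PBond P j))
    (hpp : ∀ Z, pp (pp Z) = pp Z) (V : GaugeField P j G) :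
    rOfRecord D pp fib V =
      ∑ Z'' ∈ Finset.univ.filter (fun Z => pp Z = Z), D.piece Z'' V * rQuot D pp fib Z'' V := by
  rw [rOfRecord_apply]
  have hmaps : ∀ Z ∈ (Finset.univ : Finset D.Region), pp Z ∈ Finset.univ.filter (fun Z => pp Z = Z) :=
    fun Z _ => Finset.mem_filter.mpr ⟨Finset.mem_univ _, hpp Z⟩
  rw [← Finset.sum_fiberwise_of_maps_to hmaps]
  refine Finset.sum_congr rfl fun Z'' _ => ?_
  rw [rQuot, Finset.mul_sum]
  refine Finset.sum_congr rfl fun Z hZ => ?_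
  have hZ' : pp Z = Z'' := (Finset.mem_filter.mp hZ).2
  rw [normTerm, hZ']

/-! ## §2 (0.4) for the operation of record — by name -/

/-- **(0.4) FOR `rOfRecord`**: measurable, bounded (and, by `D.nonneg`, non-negative) pieces and non-vanishing denominators give
`∫ 𝐑ρ dV = ∫ D.total dV` — the tree's `integral_ropReal_eq` applied to the decomposition's pieces. [folklore] -/
theorem integral_rOfRecord (D : LargeFieldDecomp P j G) (pp : D.Region → D.Region) (fib : D.Region → Finset (PBond P j))
    (hm : ∀ Z, Measurable (D.piece Z)) (hC : ∃ C : ℝ, ∀ Z V, D.piece Z V ≤ C)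
    (hden : ∀ Z V, fibreIntegral (fib Z) (D.piece (pp Z)) V ≠ 0) :
    ∫ V, rOfRecord D pp fib V ∂(fieldMeasure P j G) = ∫ V, D.total V ∂(fieldMeasure P j G) := by
  obtain ⟨C, hC⟩ := hC
  exact integral_ropReal_eq D.piece pp fib hm D.nonneg hC hden

/-- The same, stated with the decomposition `lfDecompR` (its total is `rOfRecord`). [folklore] -/
theorem integral_lfDecompR_total (D : LargeFieldDecomp P j G) (pp : D.Region → D.Region) (fib : D.Region → Finset (PBond P j))
    (hm : ∀ Z, Measurable (D.piece Z)) (hC : ∃ C : ℝ, ∀ Z V, D.piece Z V ≤ C)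
    (hden : ∀ Z V, fibreIntegral (fib Z) (D.piece (pp Z)) V ≠ 0) :
    ∫ V, (lfDecompR D pp fib).total V ∂(fieldMeasure P j G) = ∫ V, D.total V ∂(fieldMeasure P j G) := by
  rw [lfDecompR_total]; exact integral_rOfRecord D pp fib hm hC hden

/-! ## §3 The localised terms `𝐑(X)` of the quotient: the structural half of (0.5)∕(0.6) -/

variable {B : Type*} [DecidableEq B] [Fintype B]

/-- DATA **`rTerm`** (the D-2 terms `𝐑(X)`): the Möbius localisation at the block set `X` of `log rQuot Z″` along a restriction
lattice `res` on fields (e.g. `SubstrateLocalization.resField blk`). [cite: Balaban1989LargeFieldI, (0.6) p.176] -/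
def rTerm (res : Finset B → GaugeField P j G → GaugeField P j G) (D : LargeFieldDecomp P j G) (pp : D.Region → D.Region)
    (fib : D.Region → Finset (PBond P j)) (Z'' : D.Region) (X : Finset B) : Density P j G :=
  locTerm res (fun V => Real.log (rQuot D pp fib Z'' V)) X

/-- **THE STRUCTURAL HALF OF (0.5)∕(0.6)**: on a restriction lattice and where the quotient is positive,
`rQuot Z″ V = exp (Σ_{X ⊆ univ} 𝐑(X) V)` (Möbius inversion `locSum` of `log rQuot`, then `exp ∘ log`). [folklore] -/
theorem rQuot_eq_exp_sum_rTerm {res : Finset B → GaugeField P j G → GaugeField P j G} (hres : ResLattice res)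
    (D : LargeFieldDecomp P j G) (pp : D.Region → D.Region) (fib : D.Region → Finset (PBond P j)) (Z'' : D.Region)
    {V : GaugeField P j G} (hpos : 0 < rQuot D pp fib Z'' V) :
    rQuot D pp fib Z'' V = Real.exp (∑ X ∈ (Finset.univ : Finset B).powerset, rTerm res D pp fib Z'' X V) := by
  simp only [rTerm]
  rw [locSum hres (fun V => Real.log (rQuot D pp fib Z'' V)) V, Real.exp_log hpos]

end R

/-! ## §4 (§R-N) The split of record on nested histories -/

section RNested

variable {P : Params} {j : ℕ} {G : Type*} [DecidableEq (Plaq P j)]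

/-- DATA **`shrinkLast cls outs`**: replace the LAST outcome `Z_n` of a history `[Z₀, …, Z_n]` by `Z_n ∖ cls [Z₀,…,Z_{n−1}] Z_n`
(structural recursion; the empty history is unchanged). [folklore] -/
def shrinkLast (cls : List (Finset (Plaq P j)) → Finset (Plaq P j) → Finset (Plaq P j)) :
    List (Finset (Plaq P j)) → List (Finset (Plaq P j))
  | [] => []
  | [Z] => [Z \ cls [] Z]
  | Z :: Z' :: rest => Z :: shrinkLast (fun h => cls (Z :: h)) (Z' :: rest)

/-- `shrinkLast` on the empty history. [folklore] -/
@[simp] theorem shrinkLast_nil (cls : List (Finset (Plaq P j)) → Finset (Plaq P j) → Finset (Plaq P j)) :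
    shrinkLast cls [] = [] := rfl

/-- `shrinkLast` on a one-outcome history. [folklore] -/
@[simp] theorem shrinkLast_singleton (cls : List (Finset (Plaq P j)) → Finset (Plaq P j) → Finset (Plaq P j))
    (Z : Finset (Plaq P j)) : shrinkLast cls [Z] = [Z \ cls [] Z] := rfl

/-- `shrinkLast` keeps the head of a longer history and recurses with the history-shifted selector. [folklore] -/
@[simp] theorem shrinkLast_cons_cons (cls : List (Finset (Plaq P j)) → Finset (Plaq P j) → Finset (Plaq P j))
    (Z Z' : Finset (Plaq P j)) (rest : List (Finset (Plaq P j))) :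
    shrinkLast cls (Z :: Z' :: rest) = Z :: shrinkLast (fun h => cls (Z :: h)) (Z' :: rest) := rfl

/-- `shrinkLast` of a non-empty history is non-empty, with an explicit head. [folklore] -/
theorem shrinkLast_cons_eq (cls : List (Finset (Plaq P j)) → Finset (Plaq P j) → Finset (Plaq P j)) (Z : Finset (Plaq P j))
    (rest : List (Finset (Plaq P j))) : ∃ W rest', shrinkLast cls (Z :: rest) = W :: rest' := by
  cases rest with
  | nil => exact ⟨_, _, rfl⟩
  | cons Z' rest' => exact ⟨_, _, rfl⟩

/-- A CLASS SELECTOR: it selects a subset of the outcome, and what remains has no class part (so the split is idempotent — B15 §1: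
the components of `Z″` are exactly the non-class components of `Z`). [cite: Balaban1989LargeFieldI, §1 (i)–(ii) p.177] -/
structure IsClassSelector (cls : List (Finset (Plaq P j)) → Finset (Plaq P j) → Finset (Plaq P j)) : Prop where
  /-- the class part is a part -/
  subset : ∀ hist Z, cls hist Z ⊆ Z
  /-- no class part is left after removing it -/
  idem : ∀ hist Z, cls hist (Z \ cls hist Z) = ∅

/-- Shifting the history argument preserves being a selector. [folklore] -/
theorem IsClassSelector.shift {cls : List (Finset (Plaq P j)) → Finset (Plaq P j) → Finset (Plaq P j)} (h : IsClassSelector cls)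
    (Z : Finset (Plaq P j)) : IsClassSelector (fun hist => cls (Z :: hist)) :=
  ⟨fun hist W => h.subset (Z :: hist) W, fun hist W => h.idem (Z :: hist) W⟩

/-- **Admissible histories are closed under `shrinkLast`** of any outcome-shrinking map (`cls h Z ⊆ Z`): the last outcome gets
smaller, the earlier ones — on which the test sets depend — are unchanged.  (General history `hist`; the selector may be any
history-shift of a shrinking map.) [folklore] -/
theorem shrinkLast_mem_admissible_aux : ∀ (stages : List (Stage P j G)) (hist : List (Finset (Plaq P j)))
    (cls : List (Finset (Plaq P j)) → Finset (Plaq P j) → Finset (Plaq P j)) (_ : ∀ h Z, cls h Z ⊆ Z)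
    (outs : List (Finset (Plaq P j))), outs ∈ admissible stages hist → shrinkLast cls outs ∈ admissible stages hist
  | [], hist, cls, _, outs, houts => by
    simp only [admissible_nil, Finset.mem_singleton] at houts
    subst houts; simp
  | s :: rest, hist, cls, hsub, [], houts => (nil_not_mem_admissible_cons _ _ _ houts).elim
  | [s], hist, cls, hsub, [Z], houts => by
    obtain ⟨hZ, -⟩ := mem_admissible_cons.mp houts
    rw [shrinkLast_singleton, mem_admissible_cons]
    exact ⟨Finset.sdiff_subset.trans hZ, by simp⟩
  | s :: s' :: rest, hist, cls, hsub, [Z], houts => by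
    obtain ⟨-, h2⟩ := mem_admissible_cons.mp houts
    exact (nil_not_mem_admissible_cons _ _ _ h2).elim
  | s :: rest, hist, cls, hsub, Z :: Z' :: outs, houts => by
    obtain ⟨hZ, houts'⟩ := mem_admissible_cons.mp houts
    rw [shrinkLast_cons_cons, mem_admissible_cons]
    exact ⟨hZ, shrinkLast_mem_admissible_aux rest (hist ++ [Z]) (fun h => cls (Z :: h)) (fun h W => hsub _ W) (Z' :: outs) houts'⟩

/-- **`ShrinkLastAdmissible_stmt`**: admissible histories (from the empty history) are closed under `shrinkLast` of a selector.
[folklore] -/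
theorem shrinkLast_mem_admissible (stages : List (Stage P j G))
    {cls : List (Finset (Plaq P j)) → Finset (Plaq P j) → Finset (Plaq P j)} (hcls : IsClassSelector cls)
    {outs : List (Finset (Plaq P j))} (houts : outs ∈ admissible stages []) : shrinkLast cls outs ∈ admissible stages [] :=
  shrinkLast_mem_admissible_aux stages [] cls hcls.subset outs houts

/-- **`ShrinkLastIdem_stmt`**: for a selector, `shrinkLast cls` is idempotent. [folklore] -/
theorem shrinkLast_idem : ∀ {cls : List (Finset (Plaq P j)) → Finset (Plaq P j) → Finset (Plaq P j)} (_ : IsClassSelector cls)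
    (outs : List (Finset (Plaq P j))), shrinkLast cls (shrinkLast cls outs) = shrinkLast cls outs
  | cls, _, [] => rfl
  | cls, hcls, [Z] => by
    rw [shrinkLast_singleton, shrinkLast_singleton, hcls.idem [] Z, Finset.sdiff_empty]
  | cls, hcls, Z :: Z' :: rest => by
    rw [shrinkLast_cons_cons]
    obtain ⟨W, rest', hW⟩ := shrinkLast_cons_eq (fun h => cls (Z :: h)) Z' rest
    rw [hW, shrinkLast_cons_cons, ← hW, shrinkLast_idem (hcls.shift Z) (Z' :: rest)]

variable [GaugeGroup G] [MeasurableSpace G] [HaarData G] [DecidableEq (PBond P j)]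

/-- DATA **`ppNested`**: the split of record as an endomap of the nested regions (admissible histories), given the closure witness.
[folklore] -/
def ppNested (stages : List (Stage P j G)) (cls : List (Finset (Plaq P j)) → Finset (Plaq P j) → Finset (Plaq P j))
    (hcl : ∀ outs ∈ admissible stages [], shrinkLast cls outs ∈ admissible stages [])
    (ρ : Density P j G) (h : ∀ outs ∈ admissible stages [], ∀ V, 0 ≤ nestedPiece stages [] ρ outs V) :
    (lfDecompNested stages ρ h).Region → (lfDecompNested stages ρ h).Region :=
  fun outs => ⟨shrinkLast cls outs.1, hcl outs.1 outs.2⟩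

omit [MeasurableSpace G] [HaarData G] [DecidableEq (PBond P j)] in
/-- For a selector `ppNested` is idempotent (so `rOfRecord_fibrewise` applies to the nested operation). [folklore] -/
theorem ppNested_idem (stages : List (Stage P j G)) {cls : List (Finset (Plaq P j)) → Finset (Plaq P j) → Finset (Plaq P j)}
    (hcls : IsClassSelector cls) (hcl : ∀ outs ∈ admissible stages [], shrinkLast cls outs ∈ admissible stages [])
    (ρ : Density P j G) (h : ∀ outs ∈ admissible stages [], ∀ V, 0 ≤ nestedPiece stages [] ρ outs V)
    (outs : (lfDecompNested stages ρ h).Region) :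
    ppNested stages cls hcl ρ h (ppNested stages cls hcl ρ h outs) = ppNested stages cls hcl ρ h outs :=
  Subtype.ext (shrinkLast_idem hcls outs.1)

/-- DATA **`rNested`**: the 𝐑-operation of record on the nested decomposition (fibre variables `fib` = the bond variables attached to
the removed class part, a function of the history — supplied by the geometry). [cite: Balaban1989LargeFieldI, (0.3) p.176] -/
def rNested (stages : List (Stage P j G)) (cls : List (Finset (Plaq P j)) → Finset (Plaq P j) → Finset (Plaq P j))
    (hcl : ∀ outs ∈ admissible stages [], shrinkLast cls outs ∈ admissible stages [])
    (fib : List (Finset (Plaq P j)) → Finset (PBond P j))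
    (ρ : Density P j G) (h : ∀ outs ∈ admissible stages [], ∀ V, 0 ≤ nestedPiece stages [] ρ outs V) : Density P j G :=
  rOfRecord (lfDecompNested stages ρ h) (ppNested stages cls hcl ρ h) (fun outs => fib outs.1)

/-- **(0.4) ON THE NESTED DECOMPOSITION**: for a measurable density `0 ≤ ρ ≤ C`, stages with measurable weights in `[0,1]`, and
non-vanishing denominators, `∫ rNested … ρ … dV = ∫ ρ dV` (the total of `lfDecompNested` IS `ρ`). [folklore] -/
theorem integral_rNested (stages : List (Stage P j G)) (cls : List (Finset (Plaq P j)) → Finset (Plaq P j) → Finset (Plaq P j))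
    (hcl : ∀ outs ∈ admissible stages [], shrinkLast cls outs ∈ admissible stages [])
    (fib : List (Finset (Plaq P j)) → Finset (PBond P j)) {ρ : Density P j G} (hρm : Measurable ρ) (hρ0 : ∀ V, 0 ≤ ρ V)
    {C : ℝ} (hρC : ∀ V, ρ V ≤ C) (hwt : ∀ s ∈ stages, ∀ p V, 0 ≤ s.wt p V ∧ s.wt p V ≤ 1)
    (hwm : ∀ s ∈ stages, ∀ p, Measurable (s.wt p))
    (hden : ∀ (outs : ↥(admissible stages [])) V,
      fibreIntegral (fib outs.1) (nestedPiece stages [] ρ (shrinkLast cls outs.1)) V ≠ 0) :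
    ∫ V, rNested stages cls hcl fib ρ (fun outs _ V => nestedPiece_nonneg stages [] outs hwt (hρ0 V)) V ∂(fieldMeasure P j G) =
      ∫ V, ρ V ∂(fieldMeasure P j G) := by
  have htot := lfDecompNested_total stages ρ (fun outs _ V => nestedPiece_nonneg stages [] outs hwt (hρ0 V))
  rw [rNested, integral_rOfRecord, htot]
  · exact fun outs => measurable_nestedPiece stages [] outs.1 hwm hρm
  · exact ⟨C, fun outs V => (nestedPiece_le stages [] outs.1 hwt (hρ0 V)).trans (hρC V)⟩
  · exact fun outs V => hden outs V

end RNested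

end Summit.QuantumFields.BalabanUV.T4Continuum.SubstrateROperation
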